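/-
Origin: expansion seat `literature-prover-pub-hodgecm-cf-kudla-howe-rallis-g3-0`, handover #1 2026-08-18T06:06:39Z (`HOME/pub-hodgecm-cf-kudla-howe-rallis-g3/lean/CfKHRg3/SeesawSplittingDescent.lean`, md5 ce1dcc20, 242 lines);
landed by the gen-6 packager in gate run 24 as `HodgeCM/Automorphic/SeesawSplittingDescent.lean` (import ^import CfKHRg3\.MetaplecticUniqueness\b→import HodgeCM.Literature.MetaplecticUniqueness ×1).
-/
/-
Origin: HOME/pub-hodgecm-cf-kudla-howe-rallis-g3/lean/CfKHRg3/SeesawSplittingDescent.lean — session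
literature-prover-pub-hodgecm-cf-kudla-howe-rallis-g3-0 (unit pub-hodgecm-cf-kudla-howe-rallis-g3, CITED-FACT seat (4) gen 3).
Intended place: `HodgeCM/Automorphic/SeesawSplittingDescent.lean`; imports the landed
`HodgeCM.Automorphic.SeesawSplittingModel` (run 22) and the NEW `HodgeCM.Literature.MetaplecticUniqueness`
(handed over together — build it first; WIP import name `CfKHRg3.MetaplecticUniqueness` to be rewritten).
-/
import Summits.HodgeConjecture.HodgeCM.Automorphic.SeesawSplittingModel
import Summits.HodgeConjecture.HodgeCM.Literature.MetaplecticUniqueness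

set_option autoImplicit false

/-!
# The descent residual `jt_compat` of `SeesawCover.DoubledModel` DERIVED in the kernel
# (MVW Chap. 2 II.1 (B) + Rem. (6) and HKS96 (1.17)–(1.18) as definitions; Margulis I.(2.3.2)(b) as the one
# cited theorem) — the seesaw / metaplectic records of the theta layer have no PRINT-DERIVED field left

`HodgeCM/Automorphic/SeesawSplittingModel.lean` (run 22) derives PerL Lemma 3.4's `G_U`-side splitting
compatibility `SeesawCover.Pending_GUsideCompatible` from [Rao93, Prop. 3.7] + [HKS96, (1.12)–(1.19)] as
definitions + ONE residual field `DoubledModel.jt_compat : κ ∘ j̃ = j̃^□ ∘ (κ₁ × κ₂)`, labelled PRINT-DERIVED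
(GAPS.md cfKHRg2-G1 + ADDENDUM: "both sides are homomorphisms `Mp(𝕎₁) × Mp(𝕎₂) → Mp(𝕎^□)` over `diag` and
`ℂ×`-equivariant, and [MVW, 2.II.1, Rem. (6)] prints uniqueness of such a homomorphism").  This file executes
the ADDENDUM's KERNEL PLAN: the structure `SeesawCover.HKSDescent` has every field of `DoubledModel` EXCEPT
`jt_compat`, plus the presentation of the three covers as central extensions [MVW, 2.II.1, (B)] with Kudla's
`j̃` satisfying MVW's defining properties [Rem. (6)] (PRINT-as-DEFINITION), the content of [HKS96, (1.17)–(1.18)]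
for `κ₁, κ₂, κ` (PRINT-as-DEFINITION: `κ_j` lies over `Sp(𝕎_j) × 1` and is the identity on the central `ℂ¹`),
the block-matrix identity `(𝕎₁ ⊕ 𝕎₂)^□ = 𝕎₁^□ ⊕ 𝕎₂^□` on `Sp(𝕎_j) × 1` (DEFINITIONAL), and the ONE cited
theorem `perfect : 𝒟(Sp(𝕎_j)(k)) = Sp(𝕎_j)(k)` [Mar91, I.(2.3.2)(b)] (typed verbatim next door as
`MetaplecticSumCovers.BasePerfect`).  KERNEL: `HKSDescent.jt_compat` (by the abstract uniqueness lemma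
`eq_of_central_ratio` of `MetaplecticUniqueness.lean`), `HKSDescent.toDoubledModel`, and
`SeesawCover.pending_GUsideCompatible_of_descent`.

NET for FACTS.md §0 / LEMMAS.md §9 S5 / §10: the `G_U`-side of PerL v5 Lemma 3.4 (tex ll. 331–334, node N17) is
PRINT [Rao93 Prop. 3.7] + PRINT [Mar91 I.(2.3.2)(b)] + PRINT-as-DEFINITION [MVW 2.II.1 (B), Rem. (6); HKS96
(1.12)–(1.19)] + DEFINITIONAL (`IotaDiag`, `dbl_diag`) + KERNEL; no PRINT-DERIVED field (the one other
PRINT-DERIVED item recorded in the theta layer — PerL l. 343, Weil's proof paragraph, `WeilTheta1964.lean` — is a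
`[SETUP D4]` hypothesis of the S4 records, not of these, and is untouched).  Local at each place
`v` of `L₀`, `k = L_{0,v}` (archimedean places included — this is where Margulis' sentence is needed beyond MVW's
`p`-adic setting); adelic by restricted tensor product (LEMMAS.md D4), as for every record of the theta layer.
Non-vacuity: `HodgeCM/Automorphic/SeesawDescentSmoke.lean` instantiates every field on the scalar model of
`SeesawSplittingSmoke.lean`.
-/

noncomputable section

open scoped TensorProduct

universe u

namespace HodgeCM.Automorphic.ThetaPending

open HodgeCM.Literature.Theta

namespace WeilProductDatum

variable {Dw : WeilProductDatum.{u}}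

namespace SeesawCover

variable (C : Dw.SeesawCover)

/-- **An HKS presentation of a `SeesawCover`'s `G_U`-side WITHOUT the descent residual** — every field of
`DoubledModel` except `jt_compat`, plus the data from which `jt_compat` is DERIVED:
* `D`, `toDouble`, `κ₁ κ₂ κ`, `κ_injective`, `desc₁ desc₂ desc` — as in `DoubledModel` ([HKS96, (1.9)–(1.19)]);
* `V : MetaplecticSumCovers C.M₁ C.M₂ C.M` — the three covers as extensions (B) of [MVW, Chap. 2, II.1] by one
  central group `A` (`ℂ¹` for the covers of [HKS96, (1.12)]), with `u : A →* ℂˣ` the character by which `A`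
  acts in the Weil representations (the inclusion `ℂ¹ ⊂ ℂ^×`; for MVW's `S̃p_ψ` the identity of `ℂ^×`);
* `central` — (B) is a central extension for `𝕎₁, 𝕎₂, 𝕎` (PRINT-as-DEFINITION, [MVW 2.II.1 (B)]);
* `jt_isJ` — Kudla's `j̃ = C.jt` has MVW's defining properties: over the projections, `A`-equivariant
  (PRINT-as-DEFINITION, [MVW 2.II.1 Rem. (6)]; [Ku96 (**)]);
* `perfect` — **the one cited theorem**: `Sp(𝕎₁)(k)`, `Sp(𝕎₂)(k)` equal their commutator subgroups
  ([Mar91, Chap. I, Cor. (2.3.2)(b)], typed verbatim as `MetaplecticSumCovers.BasePerfect`; class P);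
* `dbl₁ dbl₂ dbl` — `σ ↦ (σ, 1) : Sp(𝕎_j) → Sp(𝕎_j + 𝕎_j⁻) = Sp(𝕎_j^□)` and the same for `𝕎` ([HKS96, (1.9)–
  (1.10), (1.17)]: "the image of `Sp(𝕎) × 1` in `Sp(𝕎 + 𝕎⁻)`"; SETUP, bare maps);
* `dbl_diag` — `((σ₁,1),(σ₂,1)) ↦` block-diagonal: `dbl (diag(σ₁,σ₂)) = diag^□(dbl₁ σ₁, dbl₂ σ₂)` under
  `(𝕎₁ ⊕ 𝕎₂) + (𝕎₁ ⊕ 𝕎₂)⁻ = (𝕎₁ + 𝕎₁⁻) ⊕ (𝕎₂ + 𝕎₂⁻)` (DEFINITIONAL linear algebra, LEMMAS.md D4);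
* `over₁ over₂ overSum` — [HKS96, (1.17)] AS DEFINITION (p. 952): "Now the inverse image in `Mp(𝕎 + 𝕎⁻)` of the
  image of `Sp(𝕎) × 1` (resp. `1 × Sp(𝕎)`) in `Sp(𝕎 + 𝕎⁻)` is isomorphic to `Mp(𝕎)`. … We choose a lift `ĩ` of
  `i` so that `ĩ : Mp(𝕎) × Mp(𝕎) ⟶ Mp(𝕎 + 𝕎⁻)` (1.17)" — a LIFT of `i : Sp(𝕎) × Sp(𝕎) → Sp(𝕎 + 𝕎⁻)`, i.e. over
  the projections: in the operator coordinates (1.12) of the doubled cover, `κ(m)` (= `ĩ` on the first factor) is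
  `z · r(dbl(p m))` for some scalar `z` (print: `z ∈ ℂ¹`; typed: `z ∈ ℂ^×`, weaker);
* `κi₁ κi₂ κi` — [HKS96, (1.18)] AS DEFINITION (p. 952): "This isomorphism is canonical if we specify its
  restriction to the central `ℂ¹`. … [`ĩ`] restricts to the map `ℂ¹ × ℂ¹ ⟶ ℂ¹, (ε₁, ε₂) ↦ ε₁ε̄₂` (1.18) on the
  central `ℂ¹`'s" — on the FIRST factor (the one used by (1.19) "the restriction of `ι̃_{V,χ}` to `G(W) × 1`")
  this is `ε ↦ ε`: `κ (i a) = u(a) · id` (the central `ℂ¹` of `Mp(𝕎^□) ≃ Sp(𝕎^□) × ℂ¹` is the scalars of the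
  operator model, `RaoDirectSumDatum.opOf σ z = z · r(σ)`).
Nothing is asserted; every hypothesis is a labelled field.  LOCAL at one place `v` of `L₀` (D4). -/
structure HKSDescent where
  /-- the doubled-level data ([HKS96 (1.9)–(1.16)], `SeesawSplittingModel` §1) -/
  D : GUsideDoubledDatum.{u}
  /-- `h ↦ (h, 1) : U(V₃) → U(V₃ + V₃⁻)` -/
  toDouble : Dw.H → D.K.G
  /-- (1.17) for `Mp(𝕎₁)` -/
  κ₁ : C.M₁ →* (D.R.T₁ ≃ₗ[ℂ] D.R.T₁)
  /-- (1.17) for `Mp(𝕎₂)` -/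
  κ₂ : C.M₂ →* (D.R.T₂ ≃ₗ[ℂ] D.R.T₂)
  /-- (1.17) for `Mp(𝕎)`, `𝕎 = 𝕎₁ ⊕ 𝕎₂` -/
  κ : C.M →* (D.R.T ≃ₗ[ℂ] D.R.T)
  /-- (1.17): "is isomorphic to `Mp(𝕎)`" -/
  κ_injective : Function.Injective κ
  /-- (1.19) for `ι̃_{W₁,μ₁}` -/
  desc₁ : ∀ h : Dw.H, κ₁ (C.ιV₁ h) = D.iotaTilde₁ (toDouble h)
  /-- (1.19) for `ι̃_{W₂,μ₂}` -/
  desc₂ : ∀ h : Dw.H, κ₂ (C.ιV₂ h) = D.iotaTilde₂ (toDouble h)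
  /-- (1.19) for `ι̃_{W,μ₁μ₂}` -/
  desc : ∀ h : Dw.H, κ (C.ιV h) = D.iotaTilde (toDouble h)
  /-- [MVW 2.II.1 (B)] the three covers as extensions of `Sp(𝕎₁), Sp(𝕎₂), Sp(𝕎)` by one central group `A` -/
  V : MetaplecticSumCovers C.M₁ C.M₂ C.M
  /-- the character of `A` in the Weil representations (`ℂ¹ ⊂ ℂ^×` [HKS96 (1.12)]; `id` for [MVW]'s `ℂ^×`) -/
  u : V.A →* ℂˣ
  /-- PRINT-as-DEFINITION [MVW 2.II.1 (B)]: central extensions -/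
  central : V.CentralExtensions
  /-- PRINT-as-DEFINITION [MVW 2.II.1 Rem. (6)]: Kudla's `j̃` lies over the projections and is `A`-equivariant -/
  jt_isJ : V.IsJ C.jt
  /-- **P** [Mar91, Chap. I, Cor. (2.3.2)(b)]: `𝒟(Sp(𝕎_j)(k)) = Sp(𝕎_j)(k)`, `j = 1, 2` -/
  perfect : V.BasePerfect
  /-- `σ ↦ (σ, 1) : Sp(𝕎₁) → Sp(𝕎₁^□)` ([HKS96 (1.9)–(1.10)]; SETUP) -/
  dbl₁ : V.Sp₁ → D.R.Sp₁
  /-- `σ ↦ (σ, 1) : Sp(𝕎₂) → Sp(𝕎₂^□)` -/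
  dbl₂ : V.Sp₂ → D.R.Sp₂
  /-- `σ ↦ (σ, 1) : Sp(𝕎) → Sp(𝕎^□)` -/
  dbl : V.Sp → D.R.Sp
  /-- DEFINITIONAL (block matrices): `(diag(σ₁,σ₂), 1) = diag^□((σ₁,1), (σ₂,1))` -/
  dbl_diag : ∀ (σ₁ : V.Sp₁) (σ₂ : V.Sp₂), dbl (V.diag (σ₁, σ₂)) = D.R.diag (dbl₁ σ₁, dbl₂ σ₂)
  /-- PRINT-as-DEFINITION [HKS96 (1.17)]: `κ₁ m` lies over `(p₁ m, 1) ∈ Sp(𝕎₁^□)` -/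
  over₁ : ∀ m : C.M₁, ∃ z : ℂˣ, κ₁ m = D.R.opOf₁ (dbl₁ (V.p₁ m)) z
  /-- PRINT-as-DEFINITION [HKS96 (1.17)]: `κ₂ m` lies over `(p₂ m, 1) ∈ Sp(𝕎₂^□)` -/
  over₂ : ∀ m : C.M₂, ∃ z : ℂˣ, κ₂ m = D.R.opOf₂ (dbl₂ (V.p₂ m)) z
  /-- PRINT-as-DEFINITION [HKS96 (1.17)]: `κ m` lies over `(p m, 1) ∈ Sp(𝕎^□)` -/
  overSum : ∀ m : C.M, ∃ z : ℂˣ, κ m = D.R.opOf (dbl (V.p m)) z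
  /-- PRINT-as-DEFINITION [HKS96 (1.18)]: `κ₁` is `a ↦ u(a) · id` on the central `A` -/
  κi₁ : ∀ a : V.A, κ₁ (V.i₁ a) = RaoDirectSumDatum.scale D.R.T₁ (u a)
  /-- PRINT-as-DEFINITION [HKS96 (1.18)]: `κ₂` is `a ↦ u(a) · id` on the central `A` -/
  κi₂ : ∀ a : V.A, κ₂ (V.i₂ a) = RaoDirectSumDatum.scale D.R.T₂ (u a)
  /-- PRINT-as-DEFINITION [HKS96 (1.18)]: `κ` is `a ↦ u(a) · id` on the central `A` -/
  κi : ∀ a : V.A, κ (V.i a) = RaoDirectSumDatum.scale D.R.T (u a)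

namespace HKSDescent

variable {C}
variable (X : C.HKSDescent)

/-- `K := κ ∘ j̃ : Mp(𝕎₁) × Mp(𝕎₂) → GL(T)`. -/
def Khom : C.M₁ × C.M₂ →* (X.D.R.T ≃ₗ[ℂ] X.D.R.T) :=
  X.κ.comp C.jt

/-- `J := j̃^□ ∘ (κ₁ × κ₂) : Mp(𝕎₁) × Mp(𝕎₂) → GL(T)`. -/
def Jhom : C.M₁ × C.M₂ →* (X.D.R.T ≃ₗ[ℂ] X.D.R.T) :=
  X.D.R.jOp.comp (X.κ₁.prodMap X.κ₂)

/-- (Ported verbatim from the HodgeCMPerL package; no docstring in the source.) -/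
@[simp]
theorem Khom_apply (m : C.M₁ × C.M₂) : X.Khom m = X.κ (C.jt m) := rfl

/-- (Ported verbatim from the HodgeCMPerL package; no docstring in the source.) -/
@[simp]
theorem Jhom_apply (m₁ : C.M₁) (m₂ : C.M₂) : X.Jhom (m₁, m₂) = X.D.R.jOp (X.κ₁ m₁, X.κ₂ m₂) := rfl

/-- Both `K` and `J` lie over `(m₁, m₂) ↦ diag^□((p₁ m₁, 1), (p₂ m₂, 1))` in the operator model, so they differ
by a SCALAR (kernel: `over₁`/`over₂`/`overSum`, `jt_isJ.1`, `dbl_diag`, and [Rao93 Prop. 3.7] via `StandardModelTensor.jOp_opOf`).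
-/
theorem ratio_scalar (hR : X.D.R.StandardModelTensor) (m₁ : C.M₁) (m₂ : C.M₂) :
    ∃ z : ℂˣ, X.Khom (m₁, m₂) * (X.Jhom (m₁, m₂))⁻¹ = RaoDirectSumDatum.scale X.D.R.T z := by
  obtain ⟨z, hz⟩ := X.overSum (C.jt (m₁, m₂))
  obtain ⟨z₁, hz₁⟩ := X.over₁ m₁
  obtain ⟨z₂, hz₂⟩ := X.over₂ m₂
  refine ⟨z * (z₁ * z₂)⁻¹, ?_⟩
  rw [RaoDirectSumDatum.scale_mul, RaoDirectSumDatum.scale_inv]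
  rw [Khom_apply, Jhom_apply, hz, hz₁, hz₂, hR.jOp_opOf, X.jt_isJ.1, X.dbl_diag,
    RaoDirectSumDatum.opOf_eq, RaoDirectSumDatum.opOf_eq, mul_inv_rev, ← mul_assoc,
    mul_assoc (RaoDirectSumDatum.scale X.D.R.T z), mul_inv_cancel, mul_one]

/-- Hence the ratio `K · J⁻¹` is central in `GL(T)`. -/
theorem ratio_mem_center (hR : X.D.R.StandardModelTensor) (m : C.M₁ × C.M₂) :
    X.Khom m * (X.Jhom m)⁻¹ ∈ Subgroup.center (X.D.R.T ≃ₗ[ℂ] X.D.R.T) := by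
  obtain ⟨m₁, m₂⟩ := m
  obtain ⟨z, hz⟩ := X.ratio_scalar hR m₁ m₂
  rw [hz]
  exact RaoDirectSumDatum.scale_mem_center _ z

/-- On `ker (p₁ × p₂) ⊆ i₁(A) × i₂(A)` both homomorphisms equal `(i₁ a₁, i₂ a₂) ↦ u(a₁) u(a₂) · id` (kernel:
`central` exactness, `jt_isJ` equivariance, `κi*` and `jOp_scale`). -/
theorem eq_on_ker (n : C.M₁ × C.M₂) (hn : n ∈ (X.V.p₁.prodMap X.V.p₂).ker) : X.Khom n = X.Jhom n := by
  obtain ⟨n₁, n₂⟩ := n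
  obtain ⟨⟨_, hk₁, _⟩, ⟨_, hk₂, _⟩, _⟩ := X.central
  rw [MonoidHom.mem_ker, MonoidHom.prodMap_def] at hn
  simp only [MonoidHom.prod_apply, MonoidHom.coe_comp, Function.comp_apply, MonoidHom.coe_fst,
    MonoidHom.coe_snd, Prod.mk_eq_one] at hn
  obtain ⟨a₁, ha₁⟩ := hk₁ n₁ hn.1
  obtain ⟨a₂, ha₂⟩ := hk₂ n₂ hn.2
  rw [← ha₁, ← ha₂, Khom_apply, Jhom_apply, X.κi₁, X.κi₂, RaoDirectSumDatum.jOp_scale]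
  have e : C.jt (X.V.i₁ a₁, X.V.i₂ a₂) = X.V.i a₁ * X.V.i a₂ := by
    have h1 := X.jt_isJ.2.1 a₁ 1 (X.V.i₂ a₂)
    have h2 := X.jt_isJ.2.2 a₂ 1 1
    rw [mul_one] at h1 h2
    rw [h1, h2, ← Prod.one_eq_mk, map_one, mul_one]
  rw [e, map_mul, X.κi, X.κi, ← RaoDirectSumDatum.scale_mul]

/-- **The descent residual DERIVED (kernel): `κ ∘ j̃ = j̃^□ ∘ (κ₁ × κ₂)`** — for covers presented as central
extensions [MVW 2.II.1 (B)] with `j̃` as in [MVW Rem. (6)] and `κ_j` as in [HKS96 (1.17)–(1.18)], from the ONE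
cited theorem [Mar91 I.(2.3.2)(b)] (`perfect`) and [Rao93 Prop. 3.7] (`hR`), by the abstract uniqueness lemma
`eq_of_central_ratio`. -/
theorem jt_compat (hR : X.D.R.StandardModelTensor) (m₁ : C.M₁) (m₂ : C.M₂) :
    X.κ (C.jt (m₁, m₂)) = X.D.R.jOp (X.κ₁ m₁, X.κ₂ m₂) := by
  obtain ⟨⟨_, _, hs₁⟩, ⟨_, _, hs₂⟩, _⟩ := X.central
  have hKJ : X.Khom = X.Jhom :=
    eq_of_central_ratio X.Khom X.Jhom (X.ratio_mem_center hR) (X.V.p₁.prodMap X.V.p₂).ker X.eq_on_ker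
      (commutator_sup_ker_prodMap_eq_top X.V.p₁ X.V.p₂ hs₁ hs₂ X.perfect.1 X.perfect.2)
  have h := DFunLike.congr_fun hKJ (m₁, m₂)
  rwa [Khom_apply, Jhom_apply] at h

/-- The `DoubledModel` of `SeesawSplittingModel.lean` with its residual field `jt_compat` now a THEOREM. -/
def toDoubledModel (hR : X.D.R.StandardModelTensor) : C.DoubledModel where
  D := X.D
  toDouble := X.toDouble
  κ₁ := X.κ₁
  κ₂ := X.κ₂
  κ := X.κ
  κ_injective := X.κ_injective
  desc₁ := X.desc₁
  desc₂ := X.desc₂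
  desc := X.desc
  jt_compat := X.jt_compat hR

end HKSDescent

variable {C}

/-- **`Pending_GUsideCompatible` with NO print-derived input (kernel):** for a `SeesawCover` whose `G_U`-side is
presented as in [HKS96 §1] over covers presented as in [MVW 2.II.1], PerL v5 Lemma 3.4's `G_U`-side splitting
compatibility `j̃(ι̃_{W₁,μ₁}(h), ι̃_{W₂,μ₂}(h)) = ι̃_{W,μ₁μ₂}(h)` follows from [Rao93 Prop. 3.7] (`hR`), [Mar91
I.(2.3.2)(b)] (`X.perfect`), the PRINT-as-DEFINITION fields and `IotaDiag`.  With `splittingsCompatible_of`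
([HKS96 Cor. A.3] for the `U(W)`-side) and `of_parts` this feeds `Pending_unitaryWeilRepMultiplicative`. -/
theorem pending_GUsideCompatible_of_descent (X : C.HKSDescent) (hR : X.D.R.StandardModelTensor)
    (hι : X.D.IotaDiag) : C.Pending_GUsideCompatible :=
  pending_GUsideCompatible_of_doubledModel (X.toDoubledModel hR) hR hι

end SeesawCover

end WeilProductDatum

end HodgeCM.Automorphic.ThetaPending

end
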